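import Mathlib.NumberTheory.NumberField.Basic
import Mathlib.RingTheory.IntegralClosure.IntegrallyClosed
import Mathlib.RingTheory.FiniteType
import Mathlib.RingTheory.EssentialFiniteness
import Literature.NumberTheory.DiophantineGeometry.FunctionFieldDivisors
import Literature.NumberTheory.DiophantineGeometry.FunctionFieldGenus
import HarnessLib

-- provenance: harness21/H21/H21/Statements/Abc/MordellFunctionField.lean @ 462a373 (interim HEAD d8f2665); M5 mechanical rewrite
/-!
# abc family: Faltings' theorem (Mordell conjecture) in function-field form
(trunk ArithGeomL, statement file for **abc.S14**, second formalisation; notion `curve_genus`)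

*A smooth projective curve of genus `≥ 2` over a number field `K` has only finitely many
`K`-rational points* (G. Faltings, *Endlichkeitssätze für abelsche Varietäten über Zahlkörpern*,
Invent. Math. 73 (1983), Satz 7).

This file states Faltings' theorem purely algebraically, through the accepted prelude
`Literature.Prelude.ArithGeomL.FunctionFieldGenus`: for an algebraic function field of one variable
`F/K` (`Literature.IsAlgFunctionField K F`) over a number field `K` which is its full constant field
(Mathlib `IsIntegrallyClosedIn K F`), of genus `AlgFunctionField.genus K F ≥ 2`, the set
`AlgFunctionField.ratPlaces K F` of degree-one places is finite.

## (i) What is NOT formalised: Elkies' effectivity clause (limitation repeated from `Sweep1`)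

The inventory text of abc.S14 reads "Faltings / abc ⟹ effective Mordell (Elkies 1991): a smooth
projective curve of genus `≥ 2` over a number field `K` has finitely many `K`-points (abc gives an
effective height bound)" (Faltings, Invent. 73 (1983); Elkies, IMRN 1991 no. 7). Exactly as in
`H21/Statements/Abc/Sweep1.lean`, **only the finiteness statement is formalised**. Verbatim from
`Sweep1`: the Elkies refinement "abc over `K` ⟹ an *effectively computable* bound on the height
of the points of `X(K)`" is **not** stated: it needs Weil heights on `X(K̄)` attached to a
divisor / projective embedding of a curve (H21 has heights only on `ℙⁿ(K)` via Mathlib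
`Height.logHeight` and on elliptic curves), and a formal notion of "effectively computable
constant". In inventory terms: the blocking notion `height_projective` is out of scope for G27.

## (ii) OPEN ITEM: the bridge to the swept (scheme-theoretic) form

`Sweep1` states abc.S14 as `Literature.NumberTheory.DiophantineGeometry.finite_algPoints_of_two_le_genus` for a `K`-scheme `X` with
`IsSmoothProjective 1 X`, `K`-points `AlgPoints X K` and the *Betti* genus `Literature.Abc.genus X`
(half the first Betti number of `X(ℂ)`). The present file uses `AlgFunctionField.genus K F`
(Stichtenoth's Riemann–Roch genus) and `AlgFunctionField.ratPlaces K F`. The bridge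

* `Literature.Abc.genus X` (Betti) `=` `AlgFunctionField.genus K K(X)`,
* `AlgPoints X K ≃ ratPlaces K K(X)`,
* hence `finite_algPoints_of_two_le_genus ↔ finite_ratPlaces_of_two_le_genus`,

needs `Scheme.functionField` as a `K`-algebra carrying `IsAlgFunctionField`, the regular
projective model of a function field, and GAGA; it is recorded as an **open item** in the outline
(`H21/Outlines/ArithGeomL.md` §4.4) and is **not stated** anywhere in H21. Consequently the
double formalisation of abc.S14 under one inventory id is **not** a proved (nor even a stated)
equivalence, and readers of STATUS must not read it as one. This file deliberately does not
import `Sweep1`.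

## (iii) Dictionary curves ↔ function fields

(Stichtenoth, *Algebraic Function Fields and Codes*, §I.1 and Appendix B; Hartshorne,
*Algebraic Geometry*, I.6, II.6.7–6.9, IV.1.)

* smooth projective geometrically irreducible curves `X/K` ↔ algebraic function fields `F/K` of
  one variable with `K` algebraically closed in `F` (`[IsAlgFunctionField K F]`,
  `[IsIntegrallyClosedIn K F]`), via `X ↦ K(X)` and `F ↦` its regular projective model;
* `K`-rational points `X(K)` ↔ degree-one places `AlgFunctionField.ratPlaces K F` (closed
  points of the regular model ↔ places; residue field `K` ↔ degree one);
* genus `g(X) = dim H⁰(X, Ω¹) = dim H¹(X, 𝒪_X)` ↔ `AlgFunctionField.genus K F`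
  (Stichtenoth Def. I.4.15, App. B.11; Hartshorne IV.1.1 with Riemann–Roch IV.1.3).

## Contents

* `Abc.finite_ratPlaces_of_two_le_genus` (**abc.S14**, Faltings 1983 Satz 7; `sorry`).
* `Abc.infinite_ratPlaces_of_genus_zero_of_nonempty` (untagged contrast: genus `0` with a
  rational place is `K(X)`, Stichtenoth Prop. I.6.3, hence has infinitely many rational places
  over an infinite `K`; `sorry`).
* Genus one (remark only, nothing stated): for `g = 1` with a rational place, `F = K(E)` for an
  elliptic curve `E/K` and `ratPlaces K F ≃ E(K)` is a finitely generated abelian group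
  (Mordell–Weil); it is finite iff the Mordell–Weil rank vanishes, cf. G06's `mordellWeilRank`
  in `Literature.Prelude.EllArith` (not imported here). So finiteness genuinely starts at `g = 2`.
* `Abc.finite_ratPlaces_of_two_le_genus_of_finiteType` (untagged generalisation to finitely
  generated fields of characteristic `0`; Faltings, *Complements to Mordell*, in Faltings–Wüstholz
  et al., *Rational Points*, Ch. VI, Thm. 3, combining Faltings 1983 with the function-field
  case of Manin 1963 / Grauert 1965; Lang, *Number Theory III*, I §2 and I §4; `sorry`). The
  finitely-generated-field hypothesis is spelled `[Algebra.EssFiniteType ℤ K]` exactly as in the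
  accepted hodge.S06 file `H21/Statements/Hodge/AbstractHodgeTate.lean` (for a field,
  essentially of finite type over `ℤ` ⟺ finitely generated as a field), together with
  `[CharZero K]`.
* NOT stated: the uniformity conjecture (Caporaso–Harris–Mazur) and effective Mordell (see (i)).

## Mathlib searches

Mathlib has `NumberField`, `IsIntegrallyClosedIn`, `Algebra.EssFiniteType`, `Algebra.FiniteType`,
`RatFunc`, Lüroth's theorem (`Mathlib.FieldTheory.RatFunc.Luroth`), but no genus of a function
field or curve, no places-of-degree-one API and no form of Mordell/Faltings (grep `Mordell`,
`Faltings`, `genus` in `Mathlib/`: the only `Mordell` hit is the group-theoretic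
`Mathlib.GroupTheory.Descent`, not relevant). All notions used come from the accepted preludes
`FunctionFieldDivisors` / `FunctionFieldGenus`; this file defines nothing new.

## Design notes

* `namespace Literature.Abc` (same namespace as `Sweep1`, disjoint declaration names).
* Faltings' theorem and its finitely-generated generalisation are theorems in print, hence
  `theorem … := by sorry`.
* `[NumberField K]` implies `CharZero K` and `Infinite K`; the genus-zero contrast lemma is stated
  over a number field to match the tagged theorem (the general `[Infinite K]` version for `K(X)`
  itself is `AlgFunctionField.infinite_ratPlaces_ratFunc` in the prelude).

## References

* G. Faltings, *Endlichkeitssätze für abelsche Varietäten über Zahlkörpern*, Invent. Math. 73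
  (1983), 349–366, Satz 7.
* G. Faltings, *Complements to Mordell*, Ch. VI in G. Faltings, G. Wüstholz et al., *Rational
  Points*, Aspects of Math. E6, Vieweg 1984.
* N. D. Elkies, *ABC implies Mordell*, Int. Math. Res. Notices 1991, no. 7, 99–109.
* Yu. I. Manin, *Rational points on algebraic curves over function fields*, Izv. Akad. Nauk SSSR
  27 (1963); H. Grauert, *Mordells Vermutung über rationale Punkte auf algebraischen Kurven und
  Funktionenkörper*, Publ. Math. IHÉS 25 (1965).
* S. Lang, *Number Theory III: Diophantine Geometry*, Encyclopaedia Math. Sci. 60, Ch. I.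
* H. Stichtenoth, *Algebraic Function Fields and Codes*, GTM 254, §I.1, I.4, I.6, App. B.
* R. Hartshorne, *Algebraic Geometry*, I.6, II.6, IV.1.
-/

noncomputable section

namespace Literature.NumberTheory.DiophantineGeometry

open AlgFunctionField

universe u v

variable (K : Type u) (F : Type v) [Field K] [Field F] [Algebra K F]

/-- **abc.S14** (Faltings' theorem = Mordell's conjecture, function-field form; G. Faltings,
Invent. Math. 73 (1983), §6 Satz 7 — in the English translation, Cornell–Silverman,
*Arithmetic Geometry*, Ch. II, §6, Theorem 7: "Let `X/K` be a smooth curve of genus `g ≥ 2`.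
Then `X(K)` is finite."; effective form under abc: Elkies, *ABC implies Mordell*, IMRN 1991,
no. 7 (bib key `Elkies1991ABCMordell`) — the effectivity clause is NOT formalised, see the
module docstring (i), and Elkies' result is conditional, so the source of the statement below is
Faltings 1983). Let `K` be a number field
and `F/K` an algebraic function field of one variable with full constant field `K` (i.e. the
function field of a smooth projective geometrically irreducible curve `X/K`) of genus
`g ≥ 2`. Then `F/K` has only finitely many rational (degree-one) places; equivalently `X(K)` is
finite (dictionary: module docstring (iii); the bridge to the scheme-theoretic form
`Literature.NumberTheory.DiophantineGeometry.finite_algPoints_of_two_le_genus` of `Sweep1` is an open item, (ii)). [cite: Faltings1983Endlichkeit, §6 Satz 7] -/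
def finite_ratPlaces_of_two_le_genus : Prop :=
  ∀ [NumberField K] [IsAlgFunctionField K F] [IsIntegrallyClosedIn K F] (hg : 2 ≤ genus K F),
    (ratPlaces K F).Finite

/-- Genus-zero contrast to Faltings' theorem (untagged): an algebraic function field of one
variable `F/K` of genus `0` over a number field `K` (its full constant field) which has at
least one rational place has infinitely many. Indeed a genus-`0` function field with a rational
place is rational, `F ≅ K(X)` (Stichtenoth, *Algebraic Function Fields and Codes*,
Prop. I.6.3), and `K(X)` has `#K + 1` rational places (Stichtenoth Prop. I.2.1; prelude
`AlgFunctionField.infinite_ratPlaces_ratFunc`), infinitely many since a number field is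
infinite. Geometrically: a smooth conic with a `K`-point is `ℙ¹_K`. The nonemptiness hypothesis
is necessary (pointless conics, e.g. `x² + y² + z² = 0` over `ℚ`). Second-edition numbering of
the source: Stichtenoth (2009), Prop. 1.6.3 ("`F/K` is rational iff it has genus `0` and some
divisor of degree `1`") and Cor. 1.2.3 ("the places of `K(x)/K` of degree one are in 1–1
correspondence with `K ∪ {∞}`"). Discharged in the sibling file `MordellFunctionFieldProofs`
(`infinite_ratPlaces_of_genus_zero_of_nonempty_holds`).
[cite: Stichtenoth2009, Prop. 1.6.3 and Cor. 1.2.3] -/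
def infinite_ratPlaces_of_genus_zero_of_nonempty : Prop :=
  ∀ [NumberField K] [IsAlgFunctionField K F] [IsIntegrallyClosedIn K F] (hg : genus K F = 0) (h : (ratPlaces K F).Nonempty),
    (ratPlaces K F).Infinite

/-- Faltings' theorem over finitely generated fields of characteristic zero (untagged
generalisation of **abc.S14**'s finiteness clause): if `K` is a field of characteristic `0`
which is finitely generated (over `ℚ`, equivalently over its prime ring; spelled
`[Algebra.EssFiniteType ℤ K]` as in the accepted hodge.S06 file — for a field, essentially of
finite type over `ℤ` is equivalent to finitely generated as a field) and `F/K` is an algebraic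
function field of one variable with full constant field `K` and genus `≥ 2`, then `F/K` has only
finitely many rational places, i.e. a smooth projective geometrically irreducible curve of genus
`≥ 2` over `K` has finitely many `K`-points. G. Faltings, *Complements to Mordell*, in
Faltings–Wüstholz et al., *Rational Points* (Vieweg 1984), Ch. VI, Thm. 3, by induction on the
transcendence degree of `K/ℚ` from Faltings, Invent. Math. 73 (1983), Satz 7 (number fields) and
the relative (function-field) Mordell conjecture of Manin (1963) and Grauert (Publ. Math. IHÉS 25,
1965); S. Lang, *Number Theory III*, Ch. I §§2, 4. The name keeps the outline's `finiteType`
suffix. [cite: FaltingsWustholz1984RationalPoints, Ch. VI (Faltings, Complements to Mordell), Thm. 3] -/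
def finite_ratPlaces_of_two_le_genus_of_finiteType : Prop :=
  ∀ [CharZero K] [Algebra.EssFiniteType ℤ K] [IsAlgFunctionField K F] [IsIntegrallyClosedIn K F] (hg : 2 ≤ genus K F),
    (ratPlaces K F).Finite

end Literature.NumberTheory.DiophantineGeometry
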